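import Summits.SmoothPoincare4.SmoothPoincare4.Theorems.ConvexBisectionAcyclicBisectionExistsBeltLongitudeModel
import HarnessLib

/-!
# Velocity fields of smooth families are continuous into the tangent bundle; pushing framed knots
# of the base piece through `jA` into the attached manifold
(node T3c-1 `node_belt_isotopic_pushoff` of the sub-goal T3 of stub `stub_steinRealisation` (NF6), line
`modp-braid-orbits`, crux `ConvexBisection.AcyclicBisectionExists`, item stmt-SmoothPoincare4-10508;
wave 3, worker Z5, lead c5; plumbing for stages (3a)–(3d) of V6-REPORT §2)

Two pieces of plumbing used to move the framed `r`-longitude of an attaching circle around: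

* §1 **`continuous_mk_mfderiv_family`** — if `G : X × ℝ → N` is smooth on an open set containing
  `X × {0}`, the velocity field `x ↦ (G (x, 0), d/dε|₀ G (x, ε))` is continuous into `TN` (the tangent map
  of `G` applied to the continuous section `x ↦ ((x, 0), (0, 1))` of `T(X × ℝ)`).  All framings of this
  line of work are presented this way (fibre arcs, their images under diffeomorphisms and under `jA`), so
  the continuity clauses of `IsKnotFraming` / `IsFramingAlong` become automatic.
* §2 the embedding `jA : M ∖ ⋃ cores → P` of multi-attachment data `D`: its differential is injective
  (`injective_mfderiv_jA`) and maps `T∂M` to `T∂P` (`mfderiv_jA_mem_boundaryTangentSpace`), boundary points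
  correspond (`isBoundaryPoint_jA_iff`), a knot of `∂M` off the cores is pushed to a knot of `∂P`
  (`isBoundaryKnot_jA_comp`) with velocity `d(jA)` of the velocity (`knotVelocity_jA_comp`), and a curve
  through `jA` has derivative `d(jA)` of the derivative (`hasMFDerivAt_jA_comp`);
* §3 registered helper `helper_belt_pushKnot`.

Everything is proved; no named facts.

## References
* A. A. Kosinski, *Differential Manifolds*, Academic Press (1993), VI §6. [Kosinski1993]
* J. M. Lee, *Introduction to Smooth Manifolds* (2013), Ch. 3 (tangent bundle), Ch. 5. [LeeSmoothManifolds2013]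
-/

noncomputable section

-- the prescribed namespace `Summit.<P>.<Sub>.…` duplicates `SmoothPoincare4` (P = Sub)
set_option linter.dupNamespace false

open scoped Manifold ContDiff Topology
open Set Function Metric Bundle

namespace Summit.SmoothPoincare4.SmoothPoincare4.Theorems.AcyclicBisectionExists.ModpBraidOrbits

open Literature.Topology.FourManifolds Literature.Topology.FourManifolds.HandleAttachingMap
  Literature.Geometry.Symplectic

/-! ### §1 Velocity fields of smooth families are continuous into the tangent bundle -/

section Family

variable {EX HX : Type*} [NormedAddCommGroup EX] [NormedSpace ℝ EX] [TopologicalSpace HX]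
  {IX : ModelWithCorners ℝ EX HX} {X : Type*} [TopologicalSpace X] [ChartedSpace HX X] [IsManifold IX ∞ X]
  {EN HN : Type*} [NormedAddCommGroup EN] [NormedSpace ℝ EN] [TopologicalSpace HN]
  {IN : ModelWithCorners ℝ EN HN} {N : Type*} [TopologicalSpace N] [ChartedSpace HN N] [IsManifold IN ∞ N]

omit [IsManifold IX ∞ X] [IsManifold IN ∞ N] in
/-- **The `ε`-velocity of a smooth family is its partial derivative**: for `G` differentiable at `(x, 0)`,
`d/dε|₀ G (x, ε) = dG_{(x,0)} (0, 1)`. [folklore] -/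
theorem mfderiv_family_eq (G : X × ℝ → N) {x : X}
    (hG : MDifferentiableAt (IX.prod 𝓘(ℝ, ℝ)) IN G (x, 0)) :
    mfderiv 𝓘(ℝ, ℝ) IN (fun ε : ℝ => G (x, ε)) 0 (1 : ℝ) =
      mfderiv (IX.prod 𝓘(ℝ, ℝ)) IN G (x, 0) (((0 : EX), (1 : ℝ)) : TangentSpace (IX.prod 𝓘(ℝ, ℝ)) ((x, (0 : ℝ)) : X × ℝ)) := by
  rw [mfderiv_prod_eq_add_apply hG]
  have h0 : (mfderiv IX IN (fun z : X => G (z, ((x, (0 : ℝ)) : X × ℝ).2)) ((x, (0 : ℝ)) : X × ℝ).1) (0 : EX) = 0 :=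
    map_zero _
  rw [h0, zero_add]

/-- **Velocity fields of smooth families are continuous into the tangent bundle**: if `G : X × ℝ → N` is
`C^∞` on an open `O ⊇ X × {0}`, then `x ↦ (G (x, 0), d/dε|₀ G (x, ε)) ∈ TN` is continuous.
[cite: LeeSmoothManifolds2013, Ch. 3] -/
theorem continuous_mk_mfderiv_family (G : X × ℝ → N) {O : Set (X × ℝ)} (hO : IsOpen O)
    (h0 : ∀ x, ((x, (0 : ℝ)) : X × ℝ) ∈ O) (hG : ContMDiffOn (IX.prod 𝓘(ℝ, ℝ)) IN ∞ G O) :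
    Continuous fun x : X => (TotalSpace.mk' EN (G (x, 0))
      (mfderiv 𝓘(ℝ, ℝ) IN (fun ε : ℝ => G (x, ε)) 0 (1 : ℝ)) : TangentBundle IN N) := by
  have hcont : ContinuousOn (tangentMapWithin (IX.prod 𝓘(ℝ, ℝ)) IN G O) (TotalSpace.proj ⁻¹' O) :=
    hG.continuousOn_tangentMapWithin (by simp) hO.uniqueMDiffOn
  -- the section `x ↦ ((x, 0), (0, 1))` of `T(X × ℝ)`
  set σ : X → TangentBundle (IX.prod 𝓘(ℝ, ℝ)) (X × ℝ) := fun x =>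
    (equivTangentBundleProd IX X 𝓘(ℝ, ℝ) ℝ).symm
      (zeroSection EX (TangentSpace IX : X → Type _) x,
        (tangentBundleModelSpaceHomeomorph 𝓘(ℝ, ℝ)).symm ((0 : ℝ), (1 : ℝ))) with hσ_def
  have hσc : Continuous σ := by
    have he : Continuous (equivTangentBundleProd IX X 𝓘(ℝ, ℝ) ℝ).symm :=
      (contMDiff_equivTangentBundleProd_symm (n := ∞)).continuous
    refine he.comp (Continuous.prodMk ?_ continuous_const)
    exact Bundle.Trivialization.continuous_zeroSection ℝ (F := EX) (E := (TangentSpace IX : X → Type _))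
  have hσmem : ∀ x, σ x ∈ TotalSpace.proj ⁻¹' O := fun x => h0 x
  refine (hcont.comp_continuous hσc hσmem).congr fun x => ?_
  have hσx : σ x = ⟨(x, 0), ((0 : EX), (1 : ℝ))⟩ := rfl
  have hd : MDifferentiableAt (IX.prod 𝓘(ℝ, ℝ)) IN G (x, 0) :=
    ((hG _ (h0 x)).contMDiffAt (hO.mem_nhds (h0 x))).mdifferentiableAt (by simp)
  rw [comp_apply, hσx, tangentMapWithin]
  show (TotalSpace.mk' EN (G (x, 0)) (mfderivWithin (IX.prod 𝓘(ℝ, ℝ)) IN G O (x, 0)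
      (((0 : EX), (1 : ℝ)) : TangentSpace (IX.prod 𝓘(ℝ, ℝ)) ((x, (0 : ℝ)) : X × ℝ))) : TangentBundle IN N) = _
  rw [mfderivWithin_of_isOpen hO (h0 x), ← mfderiv_family_eq G hd]

end Family

/-! ### §2 Pushing through `jA` -/

section Push

variable {ι : Type*} [Finite ι] {M : Type*} [TopologicalSpace M] [T2Space M]
  [ChartedSpace (EuclideanHalfSpace 4) M] {h : ι → HandleAttachingMap 3 2 M}
  {P : Type*} [TopologicalSpace P] [ChartedSpace (EuclideanHalfSpace 4) P]
  (D : MultiAttachmentData h (𝓡∂ 4) P)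

/-- `jA` is differentiable. [folklore] -/
theorem mdifferentiableAt_jA (a : ↥(coresComplement h)) :
    MDifferentiableAt (𝓡∂ 4) (𝓡∂ 4) D.jA a :=
  (D.hjA.contMDiff a).mdifferentiableAt (by simp)

/-- **The differential of `jA` is injective.** [folklore] -/
theorem injective_mfderiv_jA [IsManifold (𝓡∂ 4) ∞ M] [IsManifold (𝓡∂ 4) ∞ P] (a : ↥(coresComplement h)) :
    Injective (mfderiv (𝓡∂ 4) (𝓡∂ 4) D.jA a) := by
  obtain ⟨F, _, _, hF⟩ := D.hjA.isImmersion
  exact Manifold.IsImmersionAtOfComplement.mfderiv_injective (hF a) (by simp)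

/-- **Boundary points correspond under `jA`** (an open smooth embedding of the open submanifold
`M ∖ ⋃ cores`). [cite: Kosinski1993, VI §6] -/
theorem isBoundaryPoint_jA_iff [IsManifold (𝓡∂ 4) ∞ M] [IsManifold (𝓡∂ 4) ∞ P] (a : ↥(coresComplement h)) :
    (𝓡∂ 4).IsBoundaryPoint (D.jA a) ↔ (𝓡∂ 4).IsBoundaryPoint (a : M) := by
  change D.jA a ∈ (𝓡∂ 4).boundary P ↔ (a : M) ∈ (𝓡∂ 4).boundary M
  rw [mem_boundary_iff_of_isSmoothEmbedding D.hjA D.hjAo, mem_boundary_opens_iff]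

/-- Boundary points of the open submanifold `M ∖ ⋃ cores` are those of `M`. [folklore] -/
theorem isBoundaryPoint_coresComplement_iff [IsManifold (𝓡∂ 4) ∞ M] (a : ↥(coresComplement h)) :
    (𝓡∂ 4).IsBoundaryPoint a ↔ (𝓡∂ 4).IsBoundaryPoint (a : M) := by
  change a ∈ (𝓡∂ 4).boundary ↥(coresComplement h) ↔ (a : M) ∈ (𝓡∂ 4).boundary M
  rw [mem_boundary_opens_iff]

/-- **`d(jA)` maps vectors tangent to `∂M` to vectors tangent to `∂P`** (at boundary points).
[cite: Kosinski1993, VI §6] -/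
theorem mfderiv_jA_mem_boundaryTangentSpace [IsManifold (𝓡∂ 4) ∞ M] [IsManifold (𝓡∂ 4) ∞ P]
    (a : ↥(coresComplement h))
    (ha : (𝓡∂ 4).IsBoundaryPoint (a : M)) {v : EuclideanSpace ℝ (Fin 4)} (hv : v ∈ boundaryTangentSpace) :
    mfderiv (𝓡∂ 4) (𝓡∂ 4) D.jA a v ∈ boundaryTangentSpace :=
  (mem_boundaryTangentSpace_iff _).2 (mfderiv_apply_zero_of_isBoundaryPoint (mdifferentiableAt_jA D a)
    ((isBoundaryPoint_coresComplement_iff a).2 ha)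
    (Filter.Eventually.of_forall fun a' ha' => (isBoundaryPoint_jA_iff D a').2
      ((isBoundaryPoint_coresComplement_iff a').1 ha'))
    ((mem_boundaryTangentSpace_iff _).1 hv))

/-- **Chain rule through `jA`**: a map `g` into `M` with values off the cores and derivative `L` at `x`
gives `jA ∘ g` with derivative `d(jA) ∘ L`. [folklore] -/
theorem hasMFDerivAt_jA_comp {EX HX : Type*} [NormedAddCommGroup EX] [NormedSpace ℝ EX] [TopologicalSpace HX]
    {IX : ModelWithCorners ℝ EX HX} {X : Type*} [TopologicalSpace X] [ChartedSpace HX X]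
    {g : X → M} (hg : ∀ x, g x ∈ coresComplement h) {x : X} {L : EX →L[ℝ] EuclideanSpace ℝ (Fin 4)}
    (hgd : HasMFDerivAt IX (𝓡∂ 4) g x L) :
    HasMFDerivAt IX (𝓡∂ 4) (fun y => D.jA ⟨g y, hg y⟩) x
      ((mfderiv (𝓡∂ 4) (𝓡∂ 4) D.jA ⟨g x, hg x⟩).comp L) := by
  have hγ : HasMFDerivAt IX (𝓡∂ 4) (fun y => (⟨g y, hg y⟩ : ↥(coresComplement h))) x L :=
    hasMFDerivAt_codRestrict_opens (f := g) (fun y => rfl) hgd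
  exact (mdifferentiableAt_jA D _).hasMFDerivAt.comp x hγ

/-- **A knot of `∂M` off the cores is pushed by `jA` to a knot of `∂P`.** [cite: Kosinski1993, VI §6] -/
theorem isBoundaryKnot_jA_comp [IsManifold (𝓡∂ 4) ∞ M] [T2Space P] [IsManifold (𝓡∂ 4) ∞ P]
    {K : sphere (0 : EuclideanSpace ℝ (Fin 2)) 1 → M} (hK : IsBoundaryKnot K)
    (hKc : ∀ u, K u ∈ coresComplement h) :
    IsBoundaryKnot fun u => D.jA ⟨K u, hKc u⟩ := by
  -- the corestriction of `K` to the open submanifold is an embedding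
  have hemb : Manifold.IsSmoothEmbedding (𝓡 1) (𝓡∂ 4) ∞
      fun u => (⟨K u, hKc u⟩ : ↥(coresComplement h)) :=
    hK.isSmoothEmbedding.codRestrict_opens (coresComplement h) hKc
  -- `jA` as a globally defined partial diffeomorphism
  have ho : Topology.IsOpenEmbedding D.jA := ⟨D.hjA.isEmbedding, D.hjAo⟩
  haveI : Nonempty ↥(coresComplement h) := ⟨⟨K (circlePt 0), hKc _⟩⟩
  set Φ := ho.toOpenPartialHomeomorph D.jA with hΦ
  have hsrc : Φ.source = univ := ho.toOpenPartialHomeomorph_source _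
  have hcoe : ⇑Φ = D.jA := ho.toOpenPartialHomeomorph_apply _
  have hΦsm : ContMDiffOn (𝓡∂ 4) (𝓡∂ 4) ∞ Φ Φ.source := by
    rw [hcoe]; exact D.hjA.contMDiff.contMDiffOn
  have hΦ'sm : ContMDiffOn (𝓡∂ 4) (𝓡∂ 4) ∞ Φ.symm Φ.target := by
    rw [ho.toOpenPartialHomeomorph_target]
    exact contMDiffOn_symm_of_isSmoothEmbedding D.hjA ho
  have himm := hemb.isImmersion.openPartialHomeomorph_comp Φ hΦsm hΦ'sm
    (fun u => by rw [hsrc]; exact mem_univ _)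
  rw [hcoe] at himm
  have hinj : Injective fun u => D.jA ⟨K u, hKc u⟩ :=
    D.hjA.isEmbedding.injective.comp hemb.isEmbedding.injective
  have hcont : Continuous fun u => D.jA ⟨K u, hKc u⟩ :=
    D.hjA.contMDiff.continuous.comp hemb.contMDiff.continuous
  exact ⟨⟨himm, (hcont.isClosedEmbedding hinj).isEmbedding⟩,
    fun u => (isBoundaryPoint_jA_iff D _).2 (hK.isBoundaryPoint u)⟩

/-- **The velocity of the pushed knot is `d(jA)` of the velocity.** [folklore] -/
theorem knotVelocity_jA_comp {K : sphere (0 : EuclideanSpace ℝ (Fin 2)) 1 → M}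
    (hK : ContMDiff (𝓡 1) (𝓡∂ 4) ∞ K) (hKc : ∀ u, K u ∈ coresComplement h) (t : ℝ) :
    knotVelocity (fun u => D.jA ⟨K u, hKc u⟩) t =
      mfderiv (𝓡∂ 4) (𝓡∂ 4) D.jA ⟨K (circlePt t), hKc _⟩ (knotVelocity K t) := by
  have hc : MDifferentiableAt 𝓘(ℝ, ℝ) (𝓡∂ 4) (K ∘ circlePt) t :=
    ((hK _).comp t contMDiff_circlePt.contMDiffAt).mdifferentiableAt (by simp)
  have h := hasMFDerivAt_jA_comp D (fun s : ℝ => hKc (circlePt s)) hc.hasMFDerivAt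
  unfold knotVelocity
  exact congrArg (fun L : ℝ →L[ℝ] EuclideanSpace ℝ (Fin 4) => L 1) h.mfderiv

/-- **Velocity fields of families pushed through `jA`**: for `G : X × ℝ → M` smooth on an open
`O ⊇ X × {0}` with values off the cores on `O`, the pushed velocity field
`x ↦ (jA (G (x,0)), d(jA) (d/dε|₀ G (x, ε)))` is continuous into `TP`. [folklore] -/
theorem continuous_mk_mfderiv_jA_family [IsManifold (𝓡∂ 4) ∞ M] [IsManifold (𝓡∂ 4) ∞ P]
    {EX HX : Type*} [NormedAddCommGroup EX] [NormedSpace ℝ EX]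
    [TopologicalSpace HX] {IX : ModelWithCorners ℝ EX HX} {X : Type*} [TopologicalSpace X] [ChartedSpace HX X]
    [IsManifold IX ∞ X] (G : X × ℝ → M) {O : Set (X × ℝ)} (hO : IsOpen O) (h0 : ∀ x, ((x, (0 : ℝ)) : X × ℝ) ∈ O)
    (hG : ContMDiffOn (IX.prod 𝓘(ℝ, ℝ)) (𝓡∂ 4) ∞ G O) (hGc : ∀ q, G q ∈ coresComplement h) :
    Continuous fun x : X => (TotalSpace.mk' (EuclideanSpace ℝ (Fin 4)) (D.jA ⟨G (x, 0), hGc _⟩)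
      (mfderiv (𝓡∂ 4) (𝓡∂ 4) D.jA ⟨G (x, 0), hGc _⟩
        (mfderiv 𝓘(ℝ, ℝ) (𝓡∂ 4) (fun ε : ℝ => G (x, ε)) 0 (1 : ℝ))) : TangentBundle (𝓡∂ 4) P) := by
  -- the lifted family into the open submanifold and its push
  have hGh' : ContMDiffOn (IX.prod 𝓘(ℝ, ℝ)) (𝓡∂ 4) ∞
      (fun q : X × ℝ => (⟨G q, hGc q⟩ : ↥(coresComplement h))) O := fun q hq =>
    (ContMDiffWithinAt.subtypeVal_comp_iff (coresComplement h)
      (fun q : X × ℝ => (⟨G q, hGc q⟩ : ↥(coresComplement h))) O q).1 (hG q hq)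
  have hJ : ContMDiffOn (IX.prod 𝓘(ℝ, ℝ)) (𝓡∂ 4) ∞ (fun q : X × ℝ => D.jA ⟨G q, hGc q⟩) O :=
    D.hjA.contMDiff.comp_contMDiffOn hGh'
  have hc := continuous_mk_mfderiv_family (IX := IX) (IN := 𝓡∂ 4) (fun q : X × ℝ => D.jA ⟨G q, hGc q⟩) hO h0 hJ
  refine hc.congr fun x => ?_
  have hd : MDifferentiableAt 𝓘(ℝ, ℝ) (𝓡∂ 4) (fun ε : ℝ => G (x, ε)) 0 := by
    have h1 : ContMDiffAt (IX.prod 𝓘(ℝ, ℝ)) (𝓡∂ 4) ∞ G (x, 0) :=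
      (hG _ (h0 x)).contMDiffAt (hO.mem_nhds (h0 x))
    have h2 : ContMDiffAt 𝓘(ℝ, ℝ) (IX.prod 𝓘(ℝ, ℝ)) ∞ (fun ε : ℝ => ((x, ε) : X × ℝ)) 0 :=
      contMDiffAt_const.prodMk contMDiffAt_id
    have h3 := h1.comp (0 : ℝ) h2
    exact h3.mdifferentiableAt (by simp)
  have h := hasMFDerivAt_jA_comp D (fun ε : ℝ => hGc (x, ε)) hd.hasMFDerivAt
  have hv : mfderiv 𝓘(ℝ, ℝ) (𝓡∂ 4) (fun ε : ℝ => D.jA ⟨G (x, ε), hGc (x, ε)⟩) 0 (1 : ℝ) =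
      mfderiv (𝓡∂ 4) (𝓡∂ 4) D.jA ⟨G (x, 0), hGc _⟩
        (mfderiv 𝓘(ℝ, ℝ) (𝓡∂ 4) (fun ε : ℝ => G (x, ε)) 0 (1 : ℝ)) :=
    congrArg (fun L : ℝ →L[ℝ] EuclideanSpace ℝ (Fin 4) => L 1) h.mfderiv
  show (TotalSpace.mk' (EuclideanSpace ℝ (Fin 4)) (D.jA ⟨G (x, 0), hGc _⟩)
      (mfderiv 𝓘(ℝ, ℝ) (𝓡∂ 4) (fun ε : ℝ => D.jA ⟨G (x, ε), hGc (x, ε)⟩) 0 (1 : ℝ)) :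
        TangentBundle (𝓡∂ 4) P) = _
  exact congrArg _ hv

/-! ### §3 Registered helper -/

/-- **Registered helper `helper_belt_pushKnot` (node T3c-1 of NF6 `stub_steinRealisation`, plumbing for
stages (3a)–(3d), wave 3, lead c5): a knot of `∂M` off the cores of a multi-attachment is pushed by `jA`
to a knot of `∂P` whose velocity is `d(jA)` of the velocity, and `d(jA)` is injective and maps vectors
tangent to `∂M` to vectors tangent to `∂P`.** [cite: Kosinski1993, VI §6] -/
theorem helper_belt_pushKnot :
    ∀ {ι : Type} [Finite ι] {M : Type} [TopologicalSpace M] [T2Space M] [ChartedSpace (EuclideanHalfSpace 4) M]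
      [IsManifold (𝓡∂ 4) ∞ M] {h : ι → Literature.Topology.FourManifolds.HandleAttachingMap 3 2 M}
      {P : Type} [TopologicalSpace P] [T2Space P] [ChartedSpace (EuclideanHalfSpace 4) P] [IsManifold (𝓡∂ 4) ∞ P]
      (D : Literature.Topology.FourManifolds.HandleAttachingMap.MultiAttachmentData h (𝓡∂ 4) P)
      (K : Metric.sphere (0 : EuclideanSpace ℝ (Fin 2)) 1 → M)
      (hKc : ∀ u, K u ∈ Literature.Topology.FourManifolds.HandleAttachingMap.coresComplement h),
      Literature.Geometry.Symplectic.IsBoundaryKnot K →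
      Literature.Geometry.Symplectic.IsBoundaryKnot (fun u => D.jA ⟨K u, hKc u⟩) ∧
      (∀ t : ℝ, Literature.Geometry.Symplectic.knotVelocity (fun u => D.jA ⟨K u, hKc u⟩) t =
        mfderiv (𝓡∂ 4) (𝓡∂ 4) D.jA ⟨K (Literature.Topology.FourManifolds.circlePt t), hKc _⟩
          (Literature.Geometry.Symplectic.knotVelocity K t)) ∧
      (∀ u, Function.Injective (mfderiv (𝓡∂ 4) (𝓡∂ 4) D.jA ⟨K u, hKc u⟩)) ∧
      (∀ u (v : EuclideanSpace ℝ (Fin 4)), v ∈ Literature.Geometry.Symplectic.boundaryTangentSpace →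
        mfderiv (𝓡∂ 4) (𝓡∂ 4) D.jA ⟨K u, hKc u⟩ v ∈ Literature.Geometry.Symplectic.boundaryTangentSpace) := by
  intro ι _ M _ _ _ _ h P _ _ _ _ D K hKc hK
  exact ⟨isBoundaryKnot_jA_comp D hK hKc, fun t => knotVelocity_jA_comp D hK.isSmoothEmbedding.contMDiff hKc t,
    fun u => injective_mfderiv_jA D _,
    fun u v hv => mfderiv_jA_mem_boundaryTangentSpace D ⟨K u, hKc u⟩ (hK.isBoundaryPoint u) hv⟩

end Push

end Summit.SmoothPoincare4.SmoothPoincare4.Theorems.AcyclicBisectionExists.ModpBraidOrbits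

end
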